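import Summits.BirchSwinnertonDyer.BirchSwinnertonDyer.Theorems.ResidualThetaTransportAtTwoResidualSignedLambdaLowerCMAtTwoAtTwoLocalKummer
import HarnessLib

/-!
# T1 (AtTwo package), part 2: THE local value character `c₂ : 𝔉₂ →+ CharacterModule D₂` EXISTS (value-pinned on local Θ-Kummer data,
# `ℤ₂`-balanced against the functorial scalar action `DlocSMul`)

Route `ResidualThetaTransportAtTwo` (RTT), crux RSL_g `ResidualSignedLambdaLowerCMAtTwo` (stmt-BirchSwinnertonDyer-22608), line «onepair», GLUE-SPEC-g18 §1
T1 (b); seat `prover-bsd-wall-tp2-p2x-w2` g20 (`--supports`, closes nothing). THEOREMS ONLY (no definition, no named fact,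
no instance, no `sorry`). BSD is not proved by any of this; RSL_g stays OPEN.

* §1 `exists_cocycle_DlocSMul` (`DlocSMul w a [ψ] = [a • ψ]` with an explicit cocycle). The `ℤ₂`-MODULE structure through `DlocSMul` and its
  functoriality (`DlocSMul_one/_mul/_add/_zero`, `dlocModule`, `dlocModule_smul_def`) are the LEAD's `…DlocPadicModule.lean` (p702669) — not repeated here.
* §2 **`exists_c₂`** — on the habitat (`GoodSS W 2`, `κ` cyclotomic, `v ∋ 2`) there is `c₂ : ((Fin n → E(ℚ_{∞,v})) →+ ℤ₂) →+ CharacterModule D₂` with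
  (VAL) = `AtTwoPins.hc₂` VERBATIM (the value `(t(2^kQ) mod 2^k)·2^{-k}` on EVERY local Θ-Kummer datum; well defined by part 1
  `levelValue_eq_of_localKummerData`, total by `exists_localKummerData`) and (LIN) `c₂ (a • t) y = c₂ t (DlocSMul v (ι a) y)` (= `AtTwoPins.hc₂_smul` under
  `hD₂`) — the LOCAL twin of S2's `PlusValue.exists_plusPair` (p690960).

References: [Kobayashi2003] Thm. 6.2, (8.23) (p. 18); [PerrinRiou1994Invent] §3.6.1; [MilneADT2006] I §6; [Greenberg1989] §1 p. 98;
[SerreGaloisCohomology1997] I §2.2.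
-/

set_option autoImplicit false
-- the Theorems namespace of this sub repeats the summit name by design (D-0017 nested layout)
set_option linter.dupNamespace false

noncomputable section

open scoped Classical

namespace Summit.BirchSwinnertonDyer.BirchSwinnertonDyer.Theorems.ThetaTransport.AtTwoPackage

open CategoryTheory Field NumberField IsDedekindDomain WeierstrassCurve
  Literature.NumberTheory.EllipticCurves Literature.NumberTheory.GaloisRepresentations
  Literature.NumberTheory.EllipticCurves.GreenbergSelmer Literature.NumberTheory.EllipticCurves.CyclotomicLayer
  Literature.NumberTheory.EllipticCurves.Kobayashi2003 Literature.NumberTheory.EllipticCurves.Sprung2012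
  Summit.BirchSwinnertonDyer.BirchSwinnertonDyer.Theorems.OnePair

/-! ## §1 The functorial scalar action on an explicit cocycle -/

section Scalar

variable (S : Set (PadicAlgCl 2)) (κ : ZpExtension ℚ 2) (ρ : FramedGaloisRep ℚ ↥(padicCoeffIntegers S) 2) (w : HeightOneSpectrum (𝓞 ℚ))

/-- **`DlocSMul w a [ψ] = [a • ψ]`**: the scalar action on `D_w` on an explicit cocycle is the class of the cocycle with values `a • ψ(τ)`
(`cohomologyMap_oneCocycleClass`). [cite: Greenberg1989, §1 p. 98] [cite: SerreGaloisCohomology1997, I §2.2] -/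
theorem exists_cocycle_DlocSMul (a : ↥(padicCoeffIntegers S))
    (ψ : contOneCocycles (subgroupRep (localRepOf (cofreeGaloisModule S ρ) w) (kerGroup κ w))) :
    ∃ ψ' : contOneCocycles (subgroupRep (localRepOf (cofreeGaloisModule S ρ) w) (kerGroup κ w)),
      oneCocycleClass _ ψ' = DlocSMul S κ ρ w a (oneCocycleClass _ ψ) ∧
      ∀ τ, (ψ'.1 τ : Cofree ρ ↥(padicCoeffField S)) = a • (ψ.1 τ : Cofree ρ ↥(padicCoeffField S)) :=
  ⟨contOneCocycles.pullback (ContinuousMonoidHom.id _)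
      (resIdHom (subgroupRepMap (Y := localRepOf (cofreeGaloisModule S ρ) w) (cofreeLocalScalar S ρ a w) (kerGroup κ w))) ψ,
    (cohomologyMap_oneCocycleClass _ ψ).symm, fun _ ↦ rfl⟩

end Scalar

/-! ## §2 THE local value character `c₂` -/

section Character

variable (S : Set (PadicAlgCl 2)) (ρ : FramedGaloisRep ℚ ↥(padicCoeffIntegers S) 2)
  (W : WeierstrassCurve ℚ) [W.IsElliptic] [W.IsGloballyMinimal] {r : ℕ} (Θ : Cofree ρ ↥(padicCoeffField S) ≃+ (Fin r → ↥(W.geomPrimaryTorsion 2)))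
  (κ : ZpExtension ℚ 2) (v : HeightOneSpectrum (𝓞 ℚ))
  (hΘ : ∀ (δ : absoluteGaloisGroup (v.adicCompletion ℚ)) (m : Cofree ρ ↥(padicCoeffField S)) (i : Fin r),
    Θ (resGalOfEmb (closureEmb (K := ℚ) (v.adicCompletion ℚ)) δ • m) i =
      resGalOfEmb (closureEmb (K := ℚ) (v.adicCompletion ℚ)) δ • Θ m i)

set_option maxHeartbeats 800000 in
include hΘ in
/-- **THE local value character at `2` EXISTS** (GLUE-SPEC-g18 T1 (b); local twin of S2 `PlusValue.exists_plusPair`). On the habitat (`GoodSS W 2`, `κ`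
cyclotomic, `v ∋ 2`) there is `c₂ : ((Fin n → E(ℚ_{∞,v})) →+ ℤ₂) →+ CharacterModule D₂`, `D₂ = H¹(ℚ_{∞,v}, A_ρ)`, with
(VAL) `c₂ t y = (t(2^k Q) mod 2^k)·2^{-k}` on EVERY local Θ-Kummer datum `(ψ, Q, k)` of `y` (VERBATIM `AtTwoPins.hc₂`; total by `exists_localKummerData`,
well defined by `levelValue_eq_of_localKummerData`, biadditive by the sum datum and `levelValue_add`), and
(LIN) `c₂ (a • t) y = c₂ t (DlocSMul v (ι a) y)` (the scalar datum `(a • ψ, N • Q, k)`, `N = a mod 2^{E+k}`; = `AtTwoPins.hc₂_smul` once `a • y` is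
`DlocSMul v (ι a) y`). [cite: Kobayashi2003, Thm. 6.2 and (8.23) (p. 18)] [cite: PerrinRiou1994Invent, §3.6.1] [cite: MilneADT2006, Ch. I §6] -/
theorem exists_c₂ (hGood : Rank1Residual.GoodSS W 2) (hκ : κ.IsCyclotomic) (hv : ((2 : ℕ) : 𝓞 ℚ) ∈ v.asIdeal) :
    ∃ c₂ : ((Fin r → ↥(localTowerPointsOfEmb κ (closureEmb (K := ℚ) (v.adicCompletion ℚ)) W)) →+ ℤ_[2]) →+ CharacterModule (Dloc S κ ρ v),
      (∀ (t : (Fin r → ↥(localTowerPointsOfEmb κ (closureEmb (K := ℚ) (v.adicCompletion ℚ)) W)) →+ ℤ_[2])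
        (y : Dloc S κ ρ v) (ψ : contOneCocycles (subgroupRep (localRepOf (cofreeGaloisModule S ρ) v) (kerGroup κ v)))
        (Q : Fin r → localPoints W (v.adicCompletion ℚ)) (k : ℕ)
        (hQ : ∀ i, (2 ^ k) • Q i ∈ localTowerPointsOfEmb κ (closureEmb (K := ℚ) (v.adicCompletion ℚ)) W),
        oneCocycleClass (subgroupRep (localRepOf (cofreeGaloisModule S ρ) v) (kerGroup κ v)) ψ = y →
        (∀ (τ : ↥(kerGroup κ v)) (i : Fin r), pointsMapOfEmb W (closureEmb (K := ℚ) (v.adicCompletion ℚ))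
          ((Θ (ψ.1 τ) i : ↥(W.geomPrimaryTorsion 2)) : W.geomPoints) = (τ : absoluteGaloisGroup (v.adicCompletion ℚ)) • Q i - Q i) →
        c₂ t y = (PadicInt.toZModPow k (t (fun i => ⟨(2 ^ k) • Q i, hQ i⟩))).val • ((((2 : ℚ) ^ k)⁻¹ : ℚ) : AddCircle (1 : ℚ))) ∧
      (∀ (a : ℤ_[2]) (t : (Fin r → ↥(localTowerPointsOfEmb κ (closureEmb (K := ℚ) (v.adicCompletion ℚ)) W)) →+ ℤ_[2]) (y : Dloc S κ ρ v),
        c₂ (a • t) y = c₂ t (DlocSMul S κ ρ v (padicIntToCoeffIntegers S a) y)) := by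
  -- the chosen local Kummer data
  choose ψ Q k hcl hQT hkum using fun y : Dloc S κ ρ v ↦ exists_localKummerData S ρ W Θ κ v hΘ hGood hκ hv y
  -- the value on the chosen datum and its independence of the datum
  have hval : ∀ (t : (Fin r → ↥(localTowerPointsOfEmb κ (closureEmb (K := ℚ) (v.adicCompletion ℚ)) W)) →+ ℤ_[2]) (y : Dloc S κ ρ v)
      (ψ' : contOneCocycles (subgroupRep (localRepOf (cofreeGaloisModule S ρ) v) (kerGroup κ v)))
      (Q' : Fin r → localPoints W (v.adicCompletion ℚ)) (k' : ℕ)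
      (hQ' : ∀ i, (2 ^ k') • Q' i ∈ localTowerPointsOfEmb κ (closureEmb (K := ℚ) (v.adicCompletion ℚ)) W),
      oneCocycleClass _ ψ' = y →
      (∀ (τ : ↥(kerGroup κ v)) (i : Fin r), pointsMapOfEmb W (closureEmb (K := ℚ) (v.adicCompletion ℚ))
        ((Θ (ψ'.1 τ) i : ↥(W.geomPrimaryTorsion 2)) : W.geomPoints) = (τ : absoluteGaloisGroup (v.adicCompletion ℚ)) • Q' i - Q' i) →
      ((PadicInt.toZModPow (k y) (t (fun i ↦ ⟨(2 ^ k y) • Q y i, hQT y i⟩))).val • ((((2 : ℚ) ^ k y)⁻¹ : ℚ) : AddCircle (1 : ℚ)) :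
          AddCircle (1 : ℚ)) =
        (PadicInt.toZModPow k' (t (fun i ↦ ⟨(2 ^ k') • Q' i, hQ' i⟩))).val • ((((2 : ℚ) ^ k')⁻¹ : ℚ) : AddCircle (1 : ℚ)) :=
    fun t y ψ' Q' k' hQ' hψ' hK' ↦
      levelValue_eq_of_localKummerData S ρ W Θ κ v hΘ t (ψ y) ψ' (by rw [hcl y, hψ']) (Q y) Q' (k y) k' (hQT y) hQ' (hkum y) hK'
  -- additivity in `y`: the sum datum
  have hadd_y : ∀ (t : (Fin r → ↥(localTowerPointsOfEmb κ (closureEmb (K := ℚ) (v.adicCompletion ℚ)) W)) →+ ℤ_[2]) (y y' : Dloc S κ ρ v),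
      ((PadicInt.toZModPow (k (y + y')) (t (fun i ↦ ⟨(2 ^ k (y + y')) • Q (y + y') i, hQT (y + y') i⟩))).val •
          ((((2 : ℚ) ^ k (y + y'))⁻¹ : ℚ) : AddCircle (1 : ℚ)) : AddCircle (1 : ℚ)) =
        (PadicInt.toZModPow (k y) (t (fun i ↦ ⟨(2 ^ k y) • Q y i, hQT y i⟩))).val • ((((2 : ℚ) ^ k y)⁻¹ : ℚ) : AddCircle (1 : ℚ)) +
          (PadicInt.toZModPow (k y') (t (fun i ↦ ⟨(2 ^ k y') • Q y' i, hQT y' i⟩))).val • ((((2 : ℚ) ^ k y')⁻¹ : ℚ) : AddCircle (1 : ℚ)) := by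
    intro t y y'
    have hQQ : ∀ i, (2 ^ (k y + k y')) • (Q y i + Q y' i) ∈ localTowerPointsOfEmb κ (closureEmb (K := ℚ) (v.adicCompletion ℚ)) W := by
      intro i
      rw [smul_add]
      refine add_mem ?_ ?_
      · rw [pow_add, mul_comm, mul_smul]
        exact AddSubgroup.nsmul_mem _ (hQT y i) _
      · rw [pow_add, mul_smul]
        exact AddSubgroup.nsmul_mem _ (hQT y' i) _
    have hK : ∀ (τ : ↥(kerGroup κ v)) (i : Fin r), pointsMapOfEmb W (closureEmb (K := ℚ) (v.adicCompletion ℚ))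
        ((Θ ((ψ y + ψ y').1 τ) i : ↥(W.geomPrimaryTorsion 2)) : W.geomPoints) =
          (τ : absoluteGaloisGroup (v.adicCompletion ℚ)) • (Q y i + Q y' i) - (Q y i + Q y' i) := by
      intro τ i
      have e : ((ψ y + ψ y').1 τ : Cofree ρ ↥(padicCoeffField S)) = (ψ y).1 τ + (ψ y').1 τ := rfl
      rw [e, map_add, Pi.add_apply, AddMemClass.coe_add, map_add, hkum y τ i, hkum y' τ i, smul_add]
      abel
    rw [hval t (y + y') (ψ y + ψ y') (fun i ↦ Q y i + Q y' i) (k y + k y') hQQ (by rw [oneCocycleClass_add, hcl y, hcl y']) hK]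
    have hid : (fun i ↦ (⟨(2 ^ (k y + k y')) • (Q y i + Q y' i), hQQ i⟩ : ↥(localTowerPointsOfEmb κ (closureEmb (K := ℚ) (v.adicCompletion ℚ)) W))) =
        (2 ^ k y') • (fun i ↦ (⟨(2 ^ k y) • Q y i, hQT y i⟩ : ↥(localTowerPointsOfEmb κ (closureEmb (K := ℚ) (v.adicCompletion ℚ)) W))) +
          (2 ^ k y) • (fun i ↦ (⟨(2 ^ k y') • Q y' i, hQT y' i⟩ : ↥(localTowerPointsOfEmb κ (closureEmb (K := ℚ) (v.adicCompletion ℚ)) W))) := by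
      funext i
      apply Subtype.ext
      simp only [Pi.add_apply, Pi.smul_apply, AddMemClass.coe_add, AddSubgroupClass.coe_nsmul]
      rw [smul_add, smul_smul, smul_smul, ← pow_add, ← pow_add, add_comm (k y') (k y)]
    rw [hid, map_add, map_nsmul, map_nsmul, nsmul_eq_mul, nsmul_eq_mul, Nat.cast_pow, Nat.cast_pow]
    have h1 := PlusValue.levelValue_add (p := 2) (k y + k y') ((2 : ℤ_[2]) ^ k y' * t (fun i ↦ ⟨(2 ^ k y) • Q y i, hQT y i⟩))
      ((2 : ℤ_[2]) ^ k y * t (fun i ↦ ⟨(2 ^ k y') • Q y' i, hQT y' i⟩))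
    have h2 := PlusValue.levelValue_mul_pow (p := 2) (k y) (k y') (t (fun i ↦ ⟨(2 ^ k y) • Q y i, hQT y i⟩))
    have h3 := PlusValue.levelValue_mul_pow (p := 2) (k y') (k y) (t (fun i ↦ ⟨(2 ^ k y') • Q y' i, hQT y' i⟩))
    rw [add_comm (k y') (k y)] at h3
    push_cast at h1 h2 h3 ⊢
    rw [h1, h2, h3]
  -- additivity in `t`
  have hadd_t : ∀ (t t' : (Fin r → ↥(localTowerPointsOfEmb κ (closureEmb (K := ℚ) (v.adicCompletion ℚ)) W)) →+ ℤ_[2]) (y : Dloc S κ ρ v),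
      ((PadicInt.toZModPow (k y) ((t + t') (fun i ↦ ⟨(2 ^ k y) • Q y i, hQT y i⟩))).val • ((((2 : ℚ) ^ k y)⁻¹ : ℚ) : AddCircle (1 : ℚ)) :
          AddCircle (1 : ℚ)) =
        (PadicInt.toZModPow (k y) (t (fun i ↦ ⟨(2 ^ k y) • Q y i, hQT y i⟩))).val • ((((2 : ℚ) ^ k y)⁻¹ : ℚ) : AddCircle (1 : ℚ)) +
          (PadicInt.toZModPow (k y) (t' (fun i ↦ ⟨(2 ^ k y) • Q y i, hQT y i⟩))).val • ((((2 : ℚ) ^ k y)⁻¹ : ℚ) : AddCircle (1 : ℚ)) := by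
    intro t t' y
    rw [AddMonoidHom.add_apply]
    have h := PlusValue.levelValue_add (p := 2) (k y) (t (fun i ↦ ⟨(2 ^ k y) • Q y i, hQT y i⟩)) (t' (fun i ↦ ⟨(2 ^ k y) • Q y i, hQT y i⟩))
    push_cast at h ⊢
    exact h
  -- the map
  have hC : ∃ c₂ : ((Fin r → ↥(localTowerPointsOfEmb κ (closureEmb (K := ℚ) (v.adicCompletion ℚ)) W)) →+ ℤ_[2]) →+ CharacterModule (Dloc S κ ρ v),
      ∀ t y, c₂ t y = ((PadicInt.toZModPow (k y) (t (fun i ↦ ⟨(2 ^ k y) • Q y i, hQT y i⟩))).val •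
        ((((2 : ℚ) ^ k y)⁻¹ : ℚ) : AddCircle (1 : ℚ)) : AddCircle (1 : ℚ)) :=
    ⟨AddMonoidHom.mk' (fun t ↦ (AddMonoidHom.mk'
        (fun y : Dloc S κ ρ v ↦ ((PadicInt.toZModPow (k y) (t (fun i ↦ ⟨(2 ^ k y) • Q y i, hQT y i⟩))).val •
          ((((2 : ℚ) ^ k y)⁻¹ : ℚ) : AddCircle (1 : ℚ)) : AddCircle (1 : ℚ))) (hadd_y t) : CharacterModule (Dloc S κ ρ v)))
      (fun t t' ↦ DFunLike.ext _ _ fun y ↦ hadd_t t t' y), fun _ _ ↦ rfl⟩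
  obtain ⟨c₂, hc₂⟩ := hC
  refine ⟨c₂, fun t y ψ' Q' k' hQ' hψ' hK' ↦ by rw [hc₂]; exact hval t y ψ' Q' k' hQ' hψ' hK', fun a t y ↦ ?_⟩
  -- (LIN): the scalar datum `(a • ψ_y, N • Q_y, k_y)`, `N = a mod 2^(E + k_y)`
  rw [hc₂, hc₂, AddMonoidHom.smul_apply]
  obtain ⟨E, hE⟩ := exists_pow_smul_localCocycle_eq_zero S ρ W Θ κ v (ψ y)
  have hE' : ∀ τ, (2 ^ (E + k y)) • ((ψ y).1 τ : Cofree ρ ↥(padicCoeffField S)) = 0 := fun τ ↦ by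
    rw [pow_add, mul_comm, mul_smul, hE τ, smul_zero]
  obtain ⟨ψa, hψa, hψav⟩ := exists_cocycle_DlocSMul S κ ρ v (padicIntToCoeffIntegers S a) (ψ y)
  have hQa : ∀ i, (2 ^ k y) • ((PadicInt.toZModPow (E + k y) a).val • Q y i) ∈
      localTowerPointsOfEmb κ (closureEmb (K := ℚ) (v.adicCompletion ℚ)) W := fun i ↦ by
    rw [smul_comm]
    exact AddSubgroup.nsmul_mem _ (hQT y i) _
  have hKa : ∀ (τ : ↥(kerGroup κ v)) (i : Fin r), pointsMapOfEmb W (closureEmb (K := ℚ) (v.adicCompletion ℚ))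
      ((Θ (ψa.1 τ) i : ↥(W.geomPrimaryTorsion 2)) : W.geomPoints) =
        (τ : absoluteGaloisGroup (v.adicCompletion ℚ)) • ((PadicInt.toZModPow (E + k y) a).val • Q y i) -
          (PadicInt.toZModPow (E + k y) a).val • Q y i := by
    intro τ i
    have e : (ψa.1 τ : Cofree ρ ↥(padicCoeffField S)) = (PadicInt.toZModPow (E + k y) a).val • ((ψ y).1 τ : Cofree ρ ↥(padicCoeffField S)) := by
      rw [hψav τ, PlusValue.coeff_smul_eq_nsmul_of_pow_smul_eq_zero a _ (E + k y) (hE' τ)]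
    rw [e, map_nsmul, Pi.smul_apply, AddSubgroupClass.coe_nsmul, map_nsmul, hkum y τ i, smul_sub, smul_comm]
  rw [hval t (DlocSMul S κ ρ v (padicIntToCoeffIntegers S a) y) ψa _ (k y) hQa (by rw [hψa, hcl y]) hKa]
  have hid : (fun i ↦ (⟨(2 ^ k y) • ((PadicInt.toZModPow (E + k y) a).val • Q y i), hQa i⟩ :
      ↥(localTowerPointsOfEmb κ (closureEmb (K := ℚ) (v.adicCompletion ℚ)) W))) =
      (PadicInt.toZModPow (E + k y) a).val • (fun i ↦ (⟨(2 ^ k y) • Q y i, hQT y i⟩ : ↥(localTowerPointsOfEmb κ (closureEmb (K := ℚ) (v.adicCompletion ℚ)) W))) := by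
    funext i
    apply Subtype.ext
    simp only [Pi.smul_apply, AddSubgroupClass.coe_nsmul]
    rw [smul_comm]
  rw [hid, map_nsmul, PlusValue.toZModPow_smul_eq_toZModPow_nsmul (k y) E a _]

end Character

end Summit.BirchSwinnertonDyer.BirchSwinnertonDyer.Theorems.ThetaTransport.AtTwoPackage

end
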